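import Summits.MatrixMultiplication.MatrixMultiplication.Theorems.FarEdgeDescentChainCapSteps

/-!
# Far-edge descent, kernel XL-B — the floor-constrained β-dial is capped at Schönhage's order along every chain schedule (model level)

Kernel XXXIX (memo NODE-g59) left one quantitative question about the β-dial of kernel XXXVIII open
and ranked it first (critic g19, ASKS g60 (i)): under the node floors of XXXIX-G (every anchored object
must keep the fraction `(2 − a^{-j})·T_j ≤ β` of its leg mass at widths `≥ a^j`, all `j`), is the
amplification exponent of EVERY floor-respecting schedule at most the `β = 2` corner's
`κ_S = log₂(4/3)` (order `θ_S = κ_S/(1−κ_S) = 0.7095…`, the exponent of the proved `PowerAmortisation`)?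
Memo g59 §2b answered numerically for periodic and greedy chains.  This file PROVES it for ALL chain
schedules (each step squares the current object or multiplies it by a width-`a` base, in any order,
with any base anchor ratios `b ≥ β − 1`), for every `(β, z, V_min, γ)` satisfying an explicit
one-variable SQUARING CRITERION — discharged by `norm_num` for `β = 3/2` and `β = 19/10` in
`FarEdgeDescentChainCapInstances`, and numerically with margin ≈ 1.3 on all of `[3/2, 2)` (memo
NODE-g60 §2).

THE LEVER (kernel XL-A, `FarEdgeDescentWidthTransform`): the z-transform of the width cascade.  For a
node with anchor `Q`, leg masses `M(e)` at widths `a^e` and `L = Σ M(e)`, the NARROWNESS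
`V(z) = Σ_e M(e) z^{e-1} / L ∈ (0, 1]` obeys under the product `N ⊗ N'` the EXACT rule
`V_P·λ_P = λ'(1−βλ)·V' + λ(1−βλ')·V + z·λλ'·V·V'` in share coordinates `λ = L/(Q+βL)`
(`λ_P = λ + λ' − (2β−1)λλ'`), and ONE node floor at depth `j₀` gives `V(z) ≥ z^{j₀-2}·φ_{j₀}`,
`φ_j = 1 − β/(2 − a^{-j})`.  So the infinite-dimensional floor-constrained dial projects onto the
scalar chain model of this file: state (share `λ_k`, narrowness `V_k`, first-order deviation `y_k`,
size `ℓ_k`), steps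
* squaring: `λ' = 2λ − (2β−1)λ²`, `V' = (2(1−βλ)V + zλV²)/(2 − (2β−1)λ)`, `y' = 2(1−(β−1)λ)·y`,
  `ℓ' = 2ℓ`, admissible only if `V' ≥ V_min` (the projected floor);
* base step with base share `μ ∈ (0, 1/(2β−1)]` (anchor ratio `b ≥ β−1`), base deviation
  `0 ≤ y_b ≤ R·μ`, size `ℓ_b ≥ 0`: `λ' = λ + μ − (2β−1)λμ`,
  `V'λ' = μ(1−βλ) + λ(1−βμ)V + zλμV`, `y' = (1−(β−1)μ)·y + (1−(β−1)λ)·y_b`, `ℓ' = ℓ + ℓ_b`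
(the deviation rule is `deviation_linear_step` of XXXIX-J at first order, as in memo g59 §2b).

THE THEOREM (`chain_cap`): if `1 < β ≤ 2`, `0 ≤ z ≤ 1`, `0 < γ < 1`, a cut-off `V† ∈ [(2+z)/3, 1)`
with `G := log(2β/(2β−1)) − log(4/3) ≤ γ·log((1−z)/(3(1−V†)))`, and the SQUARING CRITERION
`∀ λ ∈ (0, 1/(2β−1)], V ∈ [0,1): V_min ≤ V'(λ,V) ⟹ log(2(1−(β−1)λ)/(2−(2β−1)λ)) − log(4/3) ≤ γ·(log(1−V') − log(1−V))`
hold, then along EVERY chain `log y_k ≤ log C + κ_S·(log ℓ_k − log ℓ_0)` with the explicit constant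
`C = max(3Y₀, y_0)·(λ*/λ_0)·(1−V†)^{-γ}`, `Y₀ = R(2β−1)/(β(1−γ)(β−1))`, `λ* = 1/(2β−1)`
(`chain_cap_rpow`: `y_k ≤ C·(ℓ_k/ℓ_0)^{κ_S}`).  No schedule of squarings and base steps, however
clever, amplifies faster than `ℓ^{κ_S}`: the floor-constrained dial cannot beat Schönhage's order on
chains.  PROOF = one potential, monotone at every step once `y ≥ Y₀`:
`Ψ = log y − κ_S log ℓ − log λ + γ·(−log(1 − min(V, V†)))`.
A squaring gains `E(λ) = log(2(1−(β−1)λ)/(2−(2β−1)λ)) − log(4/3)` in the first three terms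
(`≤ 0` for `λ ≤ 1/(β+1)`, `≤ G` always) and must pay `γ·log((1−V')/(1−V))⁻¹` in the last — the
criterion; a base step pays `(1−γ)·(β−1)μ` net (`base_step_key`: `λ'(1−V') ≥ λ(1−(β−1)μ)(1−V)`,
replenishment is never cheaper than its damping) which absorbs the base's own deviation once
`y ≥ Y₀`.

HONEST FRAMING: MODEL level — statements about real sequences obeying the dial's clauses; nothing
about tensors, `ω(1,k,1)` or `AnchoredLogConvexity`; no `sorry`, no new axioms, no definitions.  What
it settles: g59 §5 item 1 for chains (the numerics of g59 §2b become a theorem with an explicit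
constant); general binary product DAGs remain the typed conjecture `FloorDialCapConjecture` of
`FarEdgeDescentFloorDial` (memo NODE-g60 §3: the same potential, Hölder in the size split, meets one
extra obstruction — unreachable (small-share, degraded) states — recorded there).

References: Schönhage 1981, Thm. 3 [Schonhage1981] (`β = 2`: the corner whose order is the cap);
Coppersmith–Winograd 1982 [CoppersmithWinograd1982]; Landsberg–Ottaviani 2015, Thm. 1.1
[LandsbergOttaviani2015] (the floors, via XXXIX-G); kernels XXXVIII-B (`dial_ceiling`), XXXIX-H…L.
-/

noncomputable section

set_option linter.dupNamespace false

namespace Summit.MatrixMultiplication.MatrixMultiplication.Theorems.FarEdgeDescentChainCap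

open Summit.MatrixMultiplication.MatrixMultiplication.Theorems.FarEdgeDescentChainCapSteps

/-! ## Heavy-side invariants of a chain -/

/-- Along a chain with heavy bases the share stays in the window `(0, 1/(2β−1)]` and is
non-decreasing, the narrowness stays in `[0,1]`, deviation and size stay positive and the size is
non-decreasing. -/
theorem chain_invariants {β z : ℝ} (hβ : 1 < β) (hz0 : 0 ≤ z) (hz1 : z ≤ 1)
    (lam V y ℓ μ yb ℓb : ℕ → ℝ) (sq : ℕ → Prop)
    (hlam0 : 0 < lam 0) (hlam0' : (2 * β - 1) * lam 0 ≤ 1) (hV0 : 0 ≤ V 0) (hV0' : V 0 ≤ 1)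
    (hy0 : 0 < y 0) (hℓ0 : 0 < ℓ 0)
    (hsq_lam : ∀ k, sq k → lam (k + 1) = 2 * lam k - (2 * β - 1) * lam k ^ 2)
    (hsq_V : ∀ k, sq k → V (k + 1) =
      (2 * (1 - β * lam k) * V k + z * lam k * V k ^ 2) / (2 - (2 * β - 1) * lam k))
    (hsq_y : ∀ k, sq k → y (k + 1) = 2 * (1 - (β - 1) * lam k) * y k)
    (hsq_ℓ : ∀ k, sq k → ℓ (k + 1) = 2 * ℓ k)
    (hμ : ∀ k, ¬ sq k → 0 < μ k ∧ (2 * β - 1) * μ k ≤ 1)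
    (hb_lam : ∀ k, ¬ sq k → lam (k + 1) = lam k + μ k - (2 * β - 1) * lam k * μ k)
    (hb_V : ∀ k, ¬ sq k → V (k + 1) * lam (k + 1) =
      μ k * (1 - β * lam k) + lam k * (1 - β * μ k) * V k + z * lam k * μ k * V k)
    (hb_y : ∀ k, ¬ sq k → y (k + 1) = (1 - (β - 1) * μ k) * y k + (1 - (β - 1) * lam k) * yb k)
    (hyb : ∀ k, ¬ sq k → 0 ≤ yb k)
    (hb_ℓ : ∀ k, ¬ sq k → ℓ (k + 1) = ℓ k + ℓb k) (hℓb : ∀ k, ¬ sq k → 0 ≤ ℓb k) :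
    ∀ k, (0 < lam k ∧ (2 * β - 1) * lam k ≤ 1 ∧ lam k ≤ lam (k + 1)) ∧ (0 ≤ V k ∧ V k ≤ 1) ∧
      (0 < y k) ∧ (0 < ℓ k ∧ ℓ k ≤ ℓ (k + 1)) := by
  -- first the (lam, V) part by induction, then y and ℓ
  have hLV : ∀ k, (0 < lam k ∧ (2 * β - 1) * lam k ≤ 1) ∧ (0 ≤ V k ∧ V k ≤ 1) := by
    intro k
    induction k with
    | zero => exact ⟨⟨hlam0, hlam0'⟩, hV0, hV0'⟩
    | succ k ih =>
      obtain ⟨⟨hl0, hl1⟩, hv0, hv1⟩ := ih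
      by_cases hs : sq k
      · refine ⟨⟨?_, ?_⟩, ?_, ?_⟩
        · rw [hsq_lam k hs]; nlinarith
        · rw [hsq_lam k hs]; nlinarith [sq_nonneg ((2 * β - 1) * lam k - 1)]
        · rw [hsq_V k hs]; exact Vsq_nonneg hβ.le hz0 hl0.le hl1 hv0
        · rw [hsq_V k hs]; exact (Vsq_le hz1 hl0.le hl1 hv0 hv1).trans hv1
      · obtain ⟨hm0, hm1⟩ := hμ k hs
        have hl' : lam (k + 1) = lam k + μ k - (2 * β - 1) * lam k * μ k := hb_lam k hs
        have hlpos : 0 < lam (k + 1) := by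
          rw [hl']
          have : 0 ≤ μ k * (1 - (2 * β - 1) * lam k) := mul_nonneg hm0.le (by linarith)
          nlinarith
        refine ⟨⟨hlpos, ?_⟩, ?_, ?_⟩
        · rw [hl']
          nlinarith [mul_nonneg (sub_nonneg.2 hl1) (sub_nonneg.2 hm1)]
        · -- V' = (nonneg)/lam'
          have hnum : 0 ≤ V (k + 1) * lam (k + 1) := by
            rw [hb_V k hs]
            have h1 : 0 ≤ 1 - β * lam k := by nlinarith
            have h2 : 0 ≤ 1 - β * μ k := by nlinarith
            have := mul_nonneg hm0.le h1
            have := mul_nonneg (mul_nonneg hl0.le h2) hv0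
            have : 0 ≤ z * lam k * μ k * V k := by
              have := mul_nonneg (mul_nonneg (mul_nonneg hz0 hl0.le) hm0.le) hv0; exact this
            linarith
          rcases lt_or_ge (V (k + 1)) 0 with hneg | hok
          · have : V (k + 1) * lam (k + 1) < 0 := mul_neg_of_neg_of_pos hneg hlpos
            linarith
          · exact hok
        · -- V' ≤ 1 :  numerator ≤ lam'
          have hle : V (k + 1) * lam (k + 1) ≤ lam (k + 1) := by
            rw [hb_V k hs, hl']
            have h2 : 0 ≤ 1 - β * μ k := by nlinarith
            have hA : lam k * (1 - β * μ k) * V k ≤ lam k * (1 - β * μ k) :=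
              mul_le_of_le_one_right (mul_nonneg hl0.le h2) hv1
            have hB : z * lam k * μ k * V k ≤ lam k * μ k := by
              have hzv : z * V k ≤ 1 := by nlinarith
              have : z * lam k * μ k * V k = (z * V k) * (lam k * μ k) := by ring
              rw [this]
              exact (mul_le_of_le_one_left (mul_nonneg hl0.le hm0.le) hzv)
            nlinarith
          rcases le_or_gt (V (k + 1)) 1 with hok | hgt
          · exact hok
          · have : lam (k + 1) < V (k + 1) * lam (k + 1) := by nlinarith
            linarith
  intro k
  obtain ⟨⟨hl0, hl1⟩, hv0, hv1⟩ := hLV k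
  have hmono : lam k ≤ lam (k + 1) := by
    by_cases hs : sq k
    · rw [hsq_lam k hs]; nlinarith [mul_nonneg hl0.le (sub_nonneg.2 hl1)]
    · obtain ⟨hm0, hm1⟩ := hμ k hs
      rw [hb_lam k hs]; nlinarith [mul_nonneg hm0.le (sub_nonneg.2 hl1)]
  have hyℓ : ∀ k, 0 < y k ∧ 0 < ℓ k := by
    intro k
    induction k with
    | zero => exact ⟨hy0, hℓ0⟩
    | succ k ih =>
      obtain ⟨hy, hl⟩ := ih
      obtain ⟨⟨hk0, hk1⟩, -, -⟩ := hLV k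
      by_cases hs : sq k
      · refine ⟨?_, ?_⟩
        · rw [hsq_y k hs]
          have : 0 < 1 - (β - 1) * lam k := by nlinarith
          positivity
        · rw [hsq_ℓ k hs]; linarith
      · obtain ⟨hm0, hm1⟩ := hμ k hs
        refine ⟨?_, ?_⟩
        · rw [hb_y k hs]
          have h1 : 0 < 1 - (β - 1) * μ k := by nlinarith
          have h2 : 0 ≤ 1 - (β - 1) * lam k := by nlinarith
          have := mul_nonneg h2 (hyb k hs)
          nlinarith [mul_pos h1 hy]
        · rw [hb_ℓ k hs]; linarith [hℓb k hs]
  have hℓmono : ℓ k ≤ ℓ (k + 1) := by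
    by_cases hs : sq k
    · rw [hsq_ℓ k hs]; linarith [(hyℓ k).2]
    · rw [hb_ℓ k hs]; linarith [hℓb k hs]
  exact ⟨⟨hl0, hl1, hmono⟩, ⟨hv0, hv1⟩, (hyℓ k).1, (hyℓ k).2, hℓmono⟩

/-! ## The cap along every chain schedule -/

set_option maxHeartbeats 400000 in
/-- **Chain cap (kernel XL-B).**  Along every chain of admissible squarings and heavy base steps of
the floor-projected β-dial, the first-order deviation grows at most like `ℓ^{κ_S}`,
`κ_S = log₂(4/3)`, with an explicit constant: for all `k`,
`log y_k ≤ log max(3Y₀, y_0) + log(λ*/λ_0) − γ·log(1 − V†) + κ_S·(log ℓ_k − log ℓ_0)`. -/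
theorem chain_cap {β z Vmin γ Vd R : ℝ}
    (hβ : 1 < β) (hz0 : 0 ≤ z) (hz1 : z ≤ 1) (hγ0 : 0 < γ) (hγ1 : γ < 1) (hR : 0 ≤ R)
    (hVd1 : Vd < 1) (hVd2 : (2 + z) / 3 ≤ Vd)
    (hVd3 : Real.log (2 * β / (2 * β - 1)) - Real.log (4 / 3) ≤
      γ * (Real.log ((1 - z) / 3) - Real.log (1 - Vd)))
    (hcrit : ∀ lam V : ℝ, 0 < lam → (2 * β - 1) * lam ≤ 1 → 0 ≤ V → V < 1 →
      Vmin ≤ (2 * (1 - β * lam) * V + z * lam * V ^ 2) / (2 - (2 * β - 1) * lam) →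
      Real.log (2 * (1 - (β - 1) * lam) / (2 - (2 * β - 1) * lam)) - Real.log (4 / 3) ≤
        γ * (Real.log (1 - (2 * (1 - β * lam) * V + z * lam * V ^ 2) / (2 - (2 * β - 1) * lam))
          - Real.log (1 - V)))
    (lam V y ℓ μ yb ℓb : ℕ → ℝ) (sq : ℕ → Prop)
    (hlam0 : 0 < lam 0) (hlam0' : (2 * β - 1) * lam 0 ≤ 1) (hV0 : 0 ≤ V 0) (hV0' : V 0 ≤ 1)
    (hy0 : 0 < y 0) (hℓ0 : 0 < ℓ 0)
    (hsq_lam : ∀ k, sq k → lam (k + 1) = 2 * lam k - (2 * β - 1) * lam k ^ 2)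
    (hsq_V : ∀ k, sq k → V (k + 1) =
      (2 * (1 - β * lam k) * V k + z * lam k * V k ^ 2) / (2 - (2 * β - 1) * lam k))
    (hsq_y : ∀ k, sq k → y (k + 1) = 2 * (1 - (β - 1) * lam k) * y k)
    (hsq_ℓ : ∀ k, sq k → ℓ (k + 1) = 2 * ℓ k)
    (hsq_floor : ∀ k, sq k → Vmin ≤ V (k + 1))
    (hμ : ∀ k, ¬ sq k → 0 < μ k ∧ (2 * β - 1) * μ k ≤ 1)
    (hb_lam : ∀ k, ¬ sq k → lam (k + 1) = lam k + μ k - (2 * β - 1) * lam k * μ k)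
    (hb_V : ∀ k, ¬ sq k → V (k + 1) * lam (k + 1) =
      μ k * (1 - β * lam k) + lam k * (1 - β * μ k) * V k + z * lam k * μ k * V k)
    (hb_y : ∀ k, ¬ sq k → y (k + 1) = (1 - (β - 1) * μ k) * y k + (1 - (β - 1) * lam k) * yb k)
    (hyb : ∀ k, ¬ sq k → 0 ≤ yb k ∧ yb k ≤ R * μ k)
    (hb_ℓ : ∀ k, ¬ sq k → ℓ (k + 1) = ℓ k + ℓb k) (hℓb : ∀ k, ¬ sq k → 0 ≤ ℓb k) :
    ∀ k, Real.log (y k) ≤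
      Real.log (max (3 * (R * (2 * β - 1) / (β * (1 - γ) * (β - 1)))) (y 0))
        + (Real.log (1 / (2 * β - 1)) - Real.log (lam 0)) - γ * Real.log (1 - Vd)
        + Real.log (4 / 3) / Real.log 2 * (Real.log (ℓ k) - Real.log (ℓ 0)) := by
  have inv := chain_invariants hβ hz0 hz1 lam V y ℓ μ yb ℓb sq hlam0 hlam0' hV0 hV0' hy0 hℓ0
    hsq_lam hsq_V hsq_y hsq_ℓ hμ hb_lam hb_V hb_y (fun k hk => (hyb k hk).1) hb_ℓ hℓb
  -- abbreviations
  obtain ⟨Y₀, hY₀⟩ : ∃ Y₀ : ℝ, Y₀ = R * (2 * β - 1) / (β * (1 - γ) * (β - 1)) := ⟨_, rfl⟩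
  obtain ⟨κ, hκ⟩ : ∃ κ : ℝ, κ = Real.log (4 / 3) / Real.log 2 := ⟨_, rfl⟩
  rw [← hY₀]; simp only [← hκ]
  have hκ0 : 0 ≤ κ := by rw [hκ]; exact kappaS_nonneg
  have hγ' : 0 < 1 - γ := by linarith
  have hden : 0 < β * (1 - γ) * (β - 1) := mul_pos (mul_pos (by linarith) hγ') (by linarith)
  have hY₀0 : 0 ≤ Y₀ := by rw [hY₀]; exact div_nonneg (mul_nonneg hR (by linarith)) hden.le
  -- a base's own deviation never exceeds Y₀
  have hRμ : ∀ k, ¬ sq k → yb k ≤ Y₀ := by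
    intro k hk
    obtain ⟨hm0, hm1⟩ := hμ k hk
    have h1 : yb k ≤ R * μ k := (hyb k hk).2
    have h2 : R * μ k * (2 * β - 1) ≤ R := by
      have := mul_le_mul_of_nonneg_left hm1 hR; nlinarith
    -- R ≤ Y₀ (2β−1)  since  β(1−γ)(β−1) ≤ (2β−1)²
    have h3 : R ≤ Y₀ * (2 * β - 1) := by
      rw [hY₀, div_mul_eq_mul_div, le_div_iff₀ hden]
      have hq : β * (1 - γ) * (β - 1) ≤ (2 * β - 1) * (2 * β - 1) := by
        have : (1 - γ) * (β * (β - 1)) ≤ 1 * (β * (β - 1)) :=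
          mul_le_mul_of_nonneg_right (by linarith) (by nlinarith)
        nlinarith
      have := mul_le_mul_of_nonneg_left hq hR
      nlinarith
    nlinarith
  -- monotone quantities from the start
  have hlam_ge : ∀ k, lam 0 ≤ lam k := by
    intro k; induction k with
    | zero => exact le_rfl
    | succ k ih => exact ih.trans (inv k).1.2.2
  have hℓ_ge : ∀ k, ℓ 0 ≤ ℓ k := by
    intro k; induction k with
    | zero => exact le_rfl
    | succ k ih => exact ih.trans (inv k).2.2.2.2
  -- the potential step once y ≥ Y₀
  have hstep : ∀ k, Y₀ ≤ y k →
      Real.log (y (k + 1)) - κ * Real.log (ℓ (k + 1)) - Real.log (lam (k + 1))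
          - γ * Real.log (1 - min (V (k + 1)) Vd) ≤
        Real.log (y k) - κ * Real.log (ℓ k) - Real.log (lam k) - γ * Real.log (1 - min (V k) Vd) := by
    intro k hbig
    obtain ⟨⟨hl0, hl1, -⟩, ⟨hv0, hv1⟩, hy, hℓ, hℓle⟩ := inv k
    by_cases hs : sq k
    · rw [hκ]
      exact square_step_potential hβ hz0 hz1 hγ0 hVd1 hVd2 hVd3 hcrit hl0 hl1 hv0 hv1 hy hℓ
        (hsq_lam k hs) (hsq_V k hs) (hsq_y k hs) (hsq_ℓ k hs) (hsq_floor k hs)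
    · obtain ⟨hm0, hm1⟩ := hμ k hs
      rw [hκ]
      rw [hY₀] at hbig
      exact base_step_potential hβ hz1 hγ0 hγ1 hVd1 hl0 hl1 hm0 hm1 hv0 hy hℓ (hb_lam k hs)
        (hb_V k hs) (hb_y k hs) (hyb k hs).1 (hyb k hs).2 hℓle hbig
  -- transient bound: from below Y₀ one step reaches at most 3Y₀
  have htrans : ∀ k, y k ≤ Y₀ → y (k + 1) ≤ 3 * Y₀ := by
    intro k hk
    obtain ⟨⟨hl0, hl1, -⟩, -, hy, -, -⟩ := inv k
    have hc1 : 1 - (β - 1) * lam k ≤ 1 := by nlinarith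
    have hc0 : 0 ≤ 1 - (β - 1) * lam k := by nlinarith
    by_cases hs : sq k
    · rw [hsq_y k hs]
      have : (1 - (β - 1) * lam k) * y k ≤ y k := mul_le_of_le_one_left hy.le hc1
      nlinarith
    · obtain ⟨hm0, hm1⟩ := hμ k hs
      rw [hb_y k hs]
      have hcμ1 : 1 - (β - 1) * μ k ≤ 1 := by nlinarith
      have h1 : (1 - (β - 1) * μ k) * y k ≤ y k := mul_le_of_le_one_left hy.le hcμ1
      have h2 : (1 - (β - 1) * lam k) * yb k ≤ yb k := mul_le_of_le_one_left (hyb k hs).1 hc1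
      linarith [hRμ k hs]
  -- log facts about the cut-off
  have h1Vd : 0 < 1 - Vd := by linarith
  have hmin_log : ∀ k, Real.log (1 - Vd) ≤ Real.log (1 - min (V k) Vd) := fun k =>
    Real.log_le_log h1Vd (by linarith [min_le_right (V k) Vd])
  have hmin_log0 : ∀ k, Real.log (1 - min (V k) Vd) ≤ 0 := fun k => by
    apply Real.log_nonpos (by linarith [min_le_right (V k) Vd])
    have : 0 ≤ min (V k) Vd := le_min (inv k).2.1.1 (by linarith)
    linarith
  -- the invariant
  obtain ⟨M, hM⟩ : ∃ M : ℝ, M = Real.log (max (3 * Y₀) (y 0)) - κ * Real.log (ℓ 0)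
      - Real.log (lam 0) - γ * Real.log (1 - Vd) := ⟨_, rfl⟩
  have hmaxpos : 0 < max (3 * Y₀) (y 0) := lt_max_of_lt_right hy0
  have hI : ∀ k, y k ≤ Y₀ ∨
      Real.log (y k) - κ * Real.log (ℓ k) - Real.log (lam k) - γ * Real.log (1 - min (V k) Vd)
        ≤ M := by
    intro k
    induction k with
    | zero =>
      by_cases h0 : y 0 ≤ Y₀
      · exact Or.inl h0
      · right
        have e1 : Real.log (y 0) ≤ Real.log (max (3 * Y₀) (y 0)) :=
          Real.log_le_log hy0 (le_max_right _ _)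
        have e2 := mul_le_mul_of_nonneg_left (hmin_log 0) hγ0.le
        rw [hM]; linarith
    | succ k ih =>
      by_cases hk1 : y (k + 1) ≤ Y₀
      · exact Or.inl hk1
      · right
        by_cases hk : y k ≤ Y₀
        · -- transient
          have hyk1 : 0 < y (k + 1) := (inv (k + 1)).2.2.1
          have e1 : Real.log (y (k + 1)) ≤ Real.log (max (3 * Y₀) (y 0)) :=
            Real.log_le_log hyk1 ((htrans k hk).trans (le_max_left _ _))
          have e2 := mul_le_mul_of_nonneg_left (hmin_log (k + 1)) hγ0.le
          have e3 : κ * Real.log (ℓ 0) ≤ κ * Real.log (ℓ (k + 1)) :=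
            mul_le_mul_of_nonneg_left (Real.log_le_log hℓ0 (hℓ_ge (k + 1))) hκ0
          have e4 : Real.log (lam 0) ≤ Real.log (lam (k + 1)) :=
            Real.log_le_log hlam0 (hlam_ge (k + 1))
          rw [hM]; linarith
        · have hΨ := ih.resolve_left hk
          exact (hstep k (not_le.mp hk).le).trans hΨ
  -- conclusion
  intro k
  obtain ⟨⟨hl0, hl1, -⟩, ⟨hv0, -⟩, hy, hℓ, -⟩ := inv k
  have hlamS : Real.log (lam k) ≤ Real.log (1 / (2 * β - 1)) := by
    apply Real.log_le_log hl0
    rw [le_div_iff₀ (by linarith : (0:ℝ) < 2 * β - 1)]; linarith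
  have hlamS0 : Real.log (lam 0) ≤ Real.log (1 / (2 * β - 1)) := by
    apply Real.log_le_log hlam0
    rw [le_div_iff₀ (by linarith : (0:ℝ) < 2 * β - 1)]; linarith
  have hℓk : κ * Real.log (ℓ 0) ≤ κ * Real.log (ℓ k) :=
    mul_le_mul_of_nonneg_left (Real.log_le_log hℓ0 (hℓ_ge k)) hκ0
  have hVdlog : Real.log (1 - Vd) ≤ 0 := Real.log_nonpos h1Vd.le (by linarith)
  have e0 := mul_le_mul_of_nonneg_left hVdlog hγ0.le
  rcases hI k with hlow | hΨ
  · have e1 : Real.log (y k) ≤ Real.log (max (3 * Y₀) (y 0)) :=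
      Real.log_le_log hy ((by linarith : y k ≤ 3 * Y₀).trans (le_max_left _ _))
    linarith only [e1, hlamS0, e0, hℓk]
  · have e2 := mul_le_mul_of_nonneg_left (hmin_log0 k) hγ0.le
    rw [hM] at hΨ
    linarith only [hΨ, hlamS, e2]

/-- **Chain cap, power form.**  `y_k ≤ C · (ℓ_k/ℓ_0)^{κ_S}` with
`C = max(3Y₀, y_0) · (λ*/λ_0) · (1 − V†)^{−γ}`. -/
theorem chain_cap_rpow {β z Vmin γ Vd R : ℝ}
    (hβ : 1 < β) (hz0 : 0 ≤ z) (hz1 : z ≤ 1) (hγ0 : 0 < γ) (hγ1 : γ < 1) (hR : 0 ≤ R)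
    (hVd1 : Vd < 1) (hVd2 : (2 + z) / 3 ≤ Vd)
    (hVd3 : Real.log (2 * β / (2 * β - 1)) - Real.log (4 / 3) ≤
      γ * (Real.log ((1 - z) / 3) - Real.log (1 - Vd)))
    (hcrit : ∀ lam V : ℝ, 0 < lam → (2 * β - 1) * lam ≤ 1 → 0 ≤ V → V < 1 →
      Vmin ≤ (2 * (1 - β * lam) * V + z * lam * V ^ 2) / (2 - (2 * β - 1) * lam) →
      Real.log (2 * (1 - (β - 1) * lam) / (2 - (2 * β - 1) * lam)) - Real.log (4 / 3) ≤
        γ * (Real.log (1 - (2 * (1 - β * lam) * V + z * lam * V ^ 2) / (2 - (2 * β - 1) * lam))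
          - Real.log (1 - V)))
    (lam V y ℓ μ yb ℓb : ℕ → ℝ) (sq : ℕ → Prop)
    (hlam0 : 0 < lam 0) (hlam0' : (2 * β - 1) * lam 0 ≤ 1) (hV0 : 0 ≤ V 0) (hV0' : V 0 ≤ 1)
    (hy0 : 0 < y 0) (hℓ0 : 0 < ℓ 0)
    (hsq_lam : ∀ k, sq k → lam (k + 1) = 2 * lam k - (2 * β - 1) * lam k ^ 2)
    (hsq_V : ∀ k, sq k → V (k + 1) =
      (2 * (1 - β * lam k) * V k + z * lam k * V k ^ 2) / (2 - (2 * β - 1) * lam k))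
    (hsq_y : ∀ k, sq k → y (k + 1) = 2 * (1 - (β - 1) * lam k) * y k)
    (hsq_ℓ : ∀ k, sq k → ℓ (k + 1) = 2 * ℓ k)
    (hsq_floor : ∀ k, sq k → Vmin ≤ V (k + 1))
    (hμ : ∀ k, ¬ sq k → 0 < μ k ∧ (2 * β - 1) * μ k ≤ 1)
    (hb_lam : ∀ k, ¬ sq k → lam (k + 1) = lam k + μ k - (2 * β - 1) * lam k * μ k)
    (hb_V : ∀ k, ¬ sq k → V (k + 1) * lam (k + 1) =
      μ k * (1 - β * lam k) + lam k * (1 - β * μ k) * V k + z * lam k * μ k * V k)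
    (hb_y : ∀ k, ¬ sq k → y (k + 1) = (1 - (β - 1) * μ k) * y k + (1 - (β - 1) * lam k) * yb k)
    (hyb : ∀ k, ¬ sq k → 0 ≤ yb k ∧ yb k ≤ R * μ k)
    (hb_ℓ : ∀ k, ¬ sq k → ℓ (k + 1) = ℓ k + ℓb k) (hℓb : ∀ k, ¬ sq k → 0 ≤ ℓb k) :
    ∀ k, y k ≤ max (3 * (R * (2 * β - 1) / (β * (1 - γ) * (β - 1)))) (y 0)
      * ((1 / (2 * β - 1)) / lam 0) * (1 - Vd) ^ (-γ)
      * (ℓ k / ℓ 0) ^ (Real.log (4 / 3) / Real.log 2) := by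
  have hlog := chain_cap hβ hz0 hz1 hγ0 hγ1 hR hVd1 hVd2 hVd3 hcrit lam V y ℓ μ yb ℓb sq hlam0 hlam0'
    hV0 hV0' hy0 hℓ0 hsq_lam hsq_V hsq_y hsq_ℓ hsq_floor hμ hb_lam hb_V hb_y hyb hb_ℓ hℓb
  have inv := chain_invariants hβ hz0 hz1 lam V y ℓ μ yb ℓb sq hlam0 hlam0' hV0 hV0' hy0 hℓ0
    hsq_lam hsq_V hsq_y hsq_ℓ hμ hb_lam hb_V hb_y (fun k hk => (hyb k hk).1) hb_ℓ hℓb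
  intro k
  obtain ⟨-, -, hy, hℓ, -⟩ := inv k
  have hmaxpos : 0 < max (3 * (R * (2 * β - 1) / (β * (1 - γ) * (β - 1)))) (y 0) :=
    lt_max_of_lt_right hy0
  have hS1 : 0 < 1 / (2 * β - 1) := by rw [one_div_pos]; linarith
  have hS : 0 < (1 / (2 * β - 1)) / lam 0 := div_pos hS1 hlam0
  have h1Vd : 0 < 1 - Vd := by linarith
  have hP : 0 < (1 - Vd) ^ (-γ) := Real.rpow_pos_of_pos h1Vd _
  have hQ0 : 0 < ℓ k / ℓ 0 := div_pos hℓ hℓ0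
  have hQ : 0 < (ℓ k / ℓ 0) ^ (Real.log (4 / 3) / Real.log 2) := Real.rpow_pos_of_pos hQ0 _
  have h12 := mul_pos hmaxpos hS
  have h123 := mul_pos h12 hP
  rw [← Real.log_le_log_iff hy (mul_pos h123 hQ)]
  rw [Real.log_mul h123.ne' hQ.ne', Real.log_mul h12.ne' hP.ne',
    Real.log_mul hmaxpos.ne' hS.ne', Real.log_rpow h1Vd, Real.log_rpow hQ0,
    Real.log_div hS1.ne' hlam0.ne', Real.log_div hℓ.ne' hℓ0.ne']
  have := hlog k
  linarith

end Summit.MatrixMultiplication.MatrixMultiplication.Theorems.FarEdgeDescentChainCap
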